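import Literature.NumberTheory.Automorphic.Liu2021.Def411WeilCarriersFrameTransport
import Literature.NumberTheory.Automorphic.Liu2021.Def411WeilCarriers
import Literature.NumberTheory.GelbartRogawski1991.UnitaryDualPairSeesawCMLines
import HarnessLib

/-!
# FLOOR-0 P4, seat S4′(i), junction J-(b) — the finite Weil representation of the μ-splitting does not see the SPELLING of the line's Gram matrix

Cell hodgecm-mathlib (D-0151), FLOOR 0, crux item H413 = stmt-HodgeConjecture-24833; programme P4, line
`Cruxes/H413/Lines/F0_P4AdmissibleOccursInH1.lean`, stub S4′ `stub_T3a_holThetaRealisationOfRallisAt`.  Author F0P4-p01 (g0) (seat (i)); SEAT-i MEMO v2 §5 (J-b).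
`--supports stmt-HodgeConjecture-24833 --as helper`.  DEF-FREE; theorems only.

THE SPELLING GAP.  The pin realises `ω_V(t)` on `finPairRep` of the pair `(diag dV, J_W a)` with `J_W a = (T_W a) ⊗ L`, `T_W a = !![a]`
(★ `Def411WeilCarriers.TW ∕ JW`, ★ `omegaAtLine`), at the splitting `sChiD … a := chiSplittingLine … (T_W a) _ (J_W a) _` (★ `Item6OmegaChiSplitting` :79);
the model's theta-distribution datum (★ `Theorems/H413ThetaDistAtLine.distDatumAt_ωf`, `finRepZero_apply`) sits on `finPairRep` of the pair
`(diag dV, Matrix.diagonal (lineVec a))` with real Gram `realDiagonal (lineVec a)`.  The two Gram spellings are EQUAL MATRICES but different TERMS, so the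
groups `U(J_W)(𝔸_f)` (subgroups of ONE ambient `GL₁(𝔸_{L,f})`) and the metaplectic groups are different TYPES.  This file moves across, ON THE NOSE:

* §1 `finPairRep_congr_splitting` — `finPairRep` depends on the splitting only through its graph (rewriting `s = s'` under the `IsCompatible` proof).
* §2 **`finPairRep_chiSplittingLine_eq_of_realDiagonal`** — for ANY line data `(T_W', J_W')` with `realDiagonal dW = T_W'`, `diagonal dW = J_W'`:
  `finPairRep[diag dV, J_W', chiSplittingLine χ T_W' J_W'] (k, u) f = finPairRep[diag dV, diagonal dW, chiSplitting χ dW] (k, u') f` whenever `u`, `u'`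
  have the same underlying matrix (`subst` + ★ `chiSplittingLine_realDiagonal`; Item6's technique, cf. ★ `Item6OmegaTransportAtLine.omegaTransportAtLine`).
* §3 the instance at the pin's spelling: `realDiagonal_lineVec_eq_TW`, `diagonal_lineVec_eq_JW`, `finAdelic_JW_eq` (the two `U(J_W)(𝔸_f)` are the SAME
  subgroup of `GL₁(𝔸_{L,f})`; elements move by `MulEquiv.subgroupCongr`, same underlying matrix), and **`finPairRep_TW_eq_finPairRep_lineVec`**: the pin's finite Weil representation at `(J_W a, chiSplittingLine χ (T_W a) (J_W a))`
  (= `sChiD χ a` by definition) IS the model-spelled one at `(diagonal (lineVec a), chiSplitting χ (lineVec a))`, element by element.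

With ★ `Theorems/H413WeilCoinvTwinBridge` (J-2) and ★ `UnitaryDualPairWeilCoinvariantsReference.exists_weilCoinv_equiv_reference` (J-a: `chiSplitting χ (lineVec a)`
vs the model's `splittingOf hGR₀`, up to a continuous character), what remains of junction J is the frame congruence ∕ reindex (J-c) and the scalar
`finCharZero` (J-d) of `finRepZero_apply`, plus the line transport (LT, A-p17 (g12)).  HC_CM is proved only modulo the printed citations until rung 0 closes.

## References
* [GelbartRogawski1991] S. Gelbart, J. Rogawski, Invent. Math. 105 (1991), §3.1 p. 454, Prop. 3.1.1 p. 455 L1–3, Remark p. 457.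
* [Liu2021] Y. Liu, Camb. J. Math. 9 (2021) = arXiv:2102.11518, Def. 4.11 (l. 2092–2096), App. D §D.1 Steps 1–2 (l. 5217–5219).
* Tree: ★ `Liu2021/Def411WeilCarriersDoubling` (`splittingCongr`, `chiSplitting`, `chiSplittingLine`, `lineW`), ★ `Liu2021/Def411WeilCarriersFrameTransport`
  (`chiSplittingLine_realDiagonal`, `lineW_realDiagonal`), ★ `Liu2021/Def411WeilCarriers` (`TW`, `JW`), ★ `GelbartRogawski1991/UnitaryDualPairWeilCoinvariants` (`finPairRep`).
-/

set_option autoImplicit false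
set_option linter.dupNamespace false

noncomputable section

open scoped Matrix Kronecker
open NumberField IsDedekindDomain
open Literature.NumberTheory.Automorphic Literature.NumberTheory.Automorphic.UnitaryGroup
open Literature.NumberTheory.Weil1964
open Literature.NumberTheory.GelbartRogawski1991 Literature.NumberTheory.GelbartRogawski1991.UnitaryDualPair
open Literature.NumberTheory.GelbartRogawski1991.UnitaryDualPair.WeilCoinv
open Literature.NumberTheory.Automorphic.Liu2021.Def411WeilCarriersDoubling
open Literature.NumberTheory.Automorphic.Liu2021.Def411WeilCarriers (TW JW JW_eq isSymm_TW isUnit_det_TW)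
open Literature.NumberTheory.GelbartRogawski1991.GRConstruction (Fp)
open Literature.NumberTheory.GaloisRepresentations (HeckeCharacter)
open Literature.RepresentationTheory.HarrisKudlaSweet1996 (IsSplittingChar)

namespace Summit.HodgeConjecture.HodgeConjecture.Cruxes.H413.ThetaJunction

/-! ## §1 `finPairRep` is congruent in the splitting -/

section Congr

variable (F E : Type) [Field F] [NumberField F] [Field E] [NumberField E] [Algebra F E]
variable (c : E ≃ₐ[F] E) (N M : ℕ) {n : ℕ} (e : Fin N × Fin M ≃ Fin n)
variable (JV : Matrix (Fin N) (Fin N) E) (JW : Matrix (Fin M) (Fin M) E)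
variable {TV : Matrix (Fin N) (Fin N) F} {TW : Matrix (Fin M) (Fin M) F}
variable [Algebra.IsQuadraticExtension F E] {δ : E} (hcδ : c δ = -δ) (hδ : δ ≠ 0) {d : F}
  (hd : δ * δ = algebraMap F E d) (hV : TV.IsSymm) (hW : TW.IsSymm) (hVd : IsUnit TV.det) (hWd : IsUnit TW.det)
  (hJV : JV = TV.map (algebraMap F E)) (hJW : JW = TW.map (algebraMap F E))

/-- `finPairRep` at two EQUAL splittings (any two compatibility proofs) is the same representation. [cite: GelbartRogawski1991, §3.1 Prop. 3.1.1 p. 455 L1–3] -/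
theorem finPairRep_congr_splitting
    {s s' : UnitaryGroup.adelicPair F E c N M JV JW →* adelicMpCont F (Fin n) (adelicGram F e TV TW)} (h : s = s')
    (hs : (splittingDatum F E c N M e JV JW hcδ hδ hd hV hW hVd hWd hJV hJW).IsCompatible s)
    (hs' : (splittingDatum F E c N M e JV JW hcδ hδ hd hV hW hVd hWd hJV hJW).IsCompatible s') :
    finPairRep F E c N M e JV JW hcδ hδ hd hV hW hVd hWd hJV hJW hs = finPairRep F E c N M e JV JW hcδ hδ hd hV hW hVd hWd hJV hJW hs' := by
  subst h
  rfl

end Congr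

/-! ## §2 The μ-splitting's finite Weil representation across a re-spelling of the line's Gram matrix -/

section Line

variable (L : Type) [Field L] [NumberField L] [IsCMField L] {N' n' : ℕ} (e₁ : Fin N' × Fin 1 ≃ Fin n')
  (dV₁ : Fin N' → L) (hdV₁ : ∀ i, IsCMField.complexConj L (dV₁ i) = dV₁ i) (hdV₁0 : ∀ i, dV₁ i ≠ 0)
  (χ : HeckeCharacter L) (hχu : χ.IsUnitary) (hχs : IsSplittingChar L 1 χ)

set_option maxHeartbeats 2000000 in
-- (two `subst`s through the `splittingDatum` telescope, as in ★ `isCompatible_chiSplittingLine` ∕ `omegaTransportAtLine`)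
/-- **J-(b), parametric form.**  For a real non-zero line vector `dW` and ANY line data `(T_W', J_W')` equal to `(realDiagonal dW, diagonal dW)`
(with arbitrary proof arguments), the finite Weil representation at the splitting `chiSplittingLine χ T_W' J_W'` and at the model-spelled
`chiSplitting χ dW` AGREE on elements `(k, u)`, `(k, u')` with the same underlying matrices. [cite: GelbartRogawski1991, §3.1 Prop. 3.1.1 p. 455 L1–3]
[cite: Liu2021, App. D §D.1 Steps 1–2 (l. 5217–5219)] -/
theorem finPairRep_chiSplittingLine_eq_of_realDiagonal
    (dW : Fin 1 → L) (hdW : ∀ i, IsCMField.complexConj L (dW i) = dW i) (hdW0 : ∀ i, dW i ≠ 0)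
    (TW' : Matrix (Fin 1) (Fin 1) (Fp L)) (hW' : TW'.IsSymm) (hWd' : IsUnit TW'.det) (JW' : Matrix (Fin 1) (Fin 1) L)
    (hJW' : JW' = TW'.map (algebraMap (Fp L) L)) (hT : realDiagonal L dW hdW = TW') (hJ : Matrix.diagonal dW = JW')
    (k : UnitaryGroup.finAdelic (Fp L) L (IsCMField.complexConj L) N' (Matrix.diagonal dV₁))
    (u : UnitaryGroup.finAdelic (Fp L) L (IsCMField.complexConj L) 1 JW')
    (u' : UnitaryGroup.finAdelic (Fp L) L (IsCMField.complexConj L) 1 (Matrix.diagonal dW))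
    (huu' : (u : GL (Fin 1) (FiniteAdeleRing (𝓞 L) L)) = u') (f : FinSB (Fp L) (Fin N' × Fin 1)) :
    finPairRep (Fp L) L (IsCMField.complexConj L) N' 1 e₁ (Matrix.diagonal dV₁) JW' (complexConj_imagUnit L) (imagUnit_ne_zero L)
        (imagUnit_mul_self L) (realDiagonal_isSymm L dV₁ hdV₁) hW' (isUnit_det_realDiagonal L dV₁ hdV₁ hdV₁0) hWd'
        (realDiagonal_map L dV₁ hdV₁).symm hJW'
        (isCompatible_chiSplittingLine L e₁ dV₁ hdV₁ hdV₁0 χ hχu hχs TW' hW' hWd' JW' hJW') (k, u) f =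
      finPairRep (Fp L) L (IsCMField.complexConj L) N' 1 e₁ (Matrix.diagonal dV₁) (Matrix.diagonal dW) (complexConj_imagUnit L)
        (imagUnit_ne_zero L) (imagUnit_mul_self L) (realDiagonal_isSymm L dV₁ hdV₁) (realDiagonal_isSymm L dW hdW)
        (isUnit_det_realDiagonal L dV₁ hdV₁ hdV₁0) (isUnit_det_realDiagonal L dW hdW hdW0) (realDiagonal_map L dV₁ hdV₁).symm
        (realDiagonal_map L dW hdW).symm (isCompatible_chiSplitting L e₁ dV₁ hdV₁ hdV₁0 dW hdW hdW0 χ hχu hχs) (k, u') f := by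
  subst hT
  subst hJ
  obtain rfl : u = u' := Subtype.ext huu'
  rw [finPairRep_congr_splitting (Fp L) L (IsCMField.complexConj L) N' 1 e₁ (Matrix.diagonal dV₁) (Matrix.diagonal dW)
    (complexConj_imagUnit L) (imagUnit_ne_zero L) (imagUnit_mul_self L) (realDiagonal_isSymm L dV₁ hdV₁) hW'
    (isUnit_det_realDiagonal L dV₁ hdV₁ hdV₁0) hWd' (realDiagonal_map L dV₁ hdV₁).symm hJW'
    (chiSplittingLine_realDiagonal L χ hχu hχs e₁ dV₁ hdV₁ hdV₁0 dW hdW hdW0 hWd' hJW') _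
    (isCompatible_chiSplitting L e₁ dV₁ hdV₁ hdV₁0 dW hdW hdW0 χ hχu hχs)]

end Line

/-! ## §3 The instance at the pin's spelling `(T_W a, J_W a)`, `a ∈ (L⁺)ˣ` -/

section Pin

variable (L : Type) [Field L] [NumberField L] [IsCMField L] {N' n' : ℕ} (e₁ : Fin N' × Fin 1 ≃ Fin n')
  (dV₁ : Fin N' → L) (hdV₁ : ∀ i, IsCMField.complexConj L (dV₁ i) = dV₁ i) (hdV₁0 : ∀ i, dV₁ i ≠ 0)
  (χ : HeckeCharacter L) (hχu : χ.IsUnitary) (hχs : IsSplittingChar L 1 χ)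
  (a : (↥(maximalRealSubfield L))ˣ)

/-- the line vector of `a ∈ (L⁺)ˣ` read in `L` is real. [folklore] -/
theorem complexConj_lineVec_coe (i : Fin 1) :
    IsCMField.complexConj L (lineVec L ((a : ↥(maximalRealSubfield L)) : L) i) = lineVec L ((a : ↥(maximalRealSubfield L)) : L) i :=
  IsCMField.complexConj_apply_eq_self L (a : ↥(maximalRealSubfield L))

omit [NumberField L] [IsCMField L] in
/-- … and non-zero. [folklore] -/
theorem lineVec_coe_ne_zero (i : Fin 1) : lineVec L ((a : ↥(maximalRealSubfield L)) : L) i ≠ 0 := by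
  show ((a : ↥(maximalRealSubfield L)) : L) ≠ 0
  exact_mod_cast a.ne_zero

/-- **the two real Gram spellings agree**: `realDiagonal (lineVec a) = T_W a = !![a]`. [cite: Liu2021, App. D §D.1 Step 1 (l. 5215)] -/
theorem realDiagonal_lineVec_eq_TW :
    realDiagonal L (lineVec L ((a : ↥(maximalRealSubfield L)) : L)) (complexConj_lineVec_coe L a) = TW (↥(maximalRealSubfield L)) a := by
  ext i j
  obtain rfl : i = 0 := Subsingleton.elim _ _
  obtain rfl : j = 0 := Subsingleton.elim _ _
  rw [realDiagonal, Matrix.diagonal_apply_eq]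
  rfl

omit [NumberField L] [IsCMField L] in
/-- **the two hermitian Gram spellings agree**: `diagonal (lineVec a) = J_W a`. [cite: Liu2021, App. D §D.1 Step 1 (l. 5215)] -/
theorem diagonal_lineVec_eq_JW :
    Matrix.diagonal (lineVec L ((a : ↥(maximalRealSubfield L)) : L)) = JW (↥(maximalRealSubfield L)) L a := by
  ext i j
  obtain rfl : i = 0 := Subsingleton.elim _ _
  obtain rfl : j = 0 := Subsingleton.elim _ _
  rw [Matrix.diagonal_apply_eq]
  rfl

/-- hence the two `U(J_W)(𝔸_f)` are THE SAME subgroup of `GL₁(𝔸_{L,f})`. [folklore] -/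
theorem finAdelic_JW_eq :
    UnitaryGroup.finAdelic (↥(maximalRealSubfield L)) L (IsCMField.complexConj L) 1 (JW (↥(maximalRealSubfield L)) L a) =
      UnitaryGroup.finAdelic (↥(maximalRealSubfield L)) L (IsCMField.complexConj L) 1
        (Matrix.diagonal (lineVec L ((a : ↥(maximalRealSubfield L)) : L))) := by
  rw [diagonal_lineVec_eq_JW]

set_option maxHeartbeats 2000000 in
/-- **J-(b) AT THE PIN'S SPELLING.**  The finite Weil representation of the pair `(diag dV, J_W a)` at the line splitting
`chiSplittingLine χ (T_W a) (J_W a)` (= the pin's `sChiD χ a` by definition) IS, element by element, the finite Weil representation of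
`(diag dV, diagonal (lineVec a))` at the model-spelled `chiSplitting χ (lineVec a)` — for ANY proof arguments on the pin side.
[cite: GelbartRogawski1991, §3.1 Prop. 3.1.1 p. 455 L1–3] [cite: Liu2021, App. D §D.1 Steps 1–2 (l. 5217–5219)] -/
theorem finPairRep_TW_eq_finPairRep_lineVec
    (hW : (TW (↥(maximalRealSubfield L)) a).IsSymm) (hWd : IsUnit (TW (↥(maximalRealSubfield L)) a).det)
    (hJW : JW (↥(maximalRealSubfield L)) L a = (TW (↥(maximalRealSubfield L)) a).map (algebraMap (↥(maximalRealSubfield L)) L))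
    (k : UnitaryGroup.finAdelic (↥(maximalRealSubfield L)) L (IsCMField.complexConj L) N' (Matrix.diagonal dV₁))
    (u : UnitaryGroup.finAdelic (↥(maximalRealSubfield L)) L (IsCMField.complexConj L) 1 (JW (↥(maximalRealSubfield L)) L a))
    (u' : UnitaryGroup.finAdelic (↥(maximalRealSubfield L)) L (IsCMField.complexConj L) 1
      (Matrix.diagonal (lineVec L ((a : ↥(maximalRealSubfield L)) : L))))
    (huu' : (u : GL (Fin 1) (FiniteAdeleRing (𝓞 L) L)) = u') (f : FinSB (↥(maximalRealSubfield L)) (Fin N' × Fin 1)) :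
    finPairRep (↥(maximalRealSubfield L)) L (IsCMField.complexConj L) N' 1 e₁ (Matrix.diagonal dV₁) (JW (↥(maximalRealSubfield L)) L a)
        (complexConj_imagUnit L) (imagUnit_ne_zero L) (imagUnit_mul_self L) (realDiagonal_isSymm L dV₁ hdV₁) hW
        (isUnit_det_realDiagonal L dV₁ hdV₁ hdV₁0) hWd (realDiagonal_map L dV₁ hdV₁).symm hJW
        (isCompatible_chiSplittingLine L e₁ dV₁ hdV₁ hdV₁0 χ hχu hχs (TW (↥(maximalRealSubfield L)) a) hW hWd
          (JW (↥(maximalRealSubfield L)) L a) hJW) (k, u) f =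
      finPairRep (↥(maximalRealSubfield L)) L (IsCMField.complexConj L) N' 1 e₁ (Matrix.diagonal dV₁)
        (Matrix.diagonal (lineVec L ((a : ↥(maximalRealSubfield L)) : L))) (complexConj_imagUnit L) (imagUnit_ne_zero L)
        (imagUnit_mul_self L) (realDiagonal_isSymm L dV₁ hdV₁) (realDiagonal_isSymm L _ (complexConj_lineVec_coe L a))
        (isUnit_det_realDiagonal L dV₁ hdV₁ hdV₁0) (isUnit_det_realDiagonal L _ (complexConj_lineVec_coe L a) (lineVec_coe_ne_zero L a))
        (realDiagonal_map L dV₁ hdV₁).symm (realDiagonal_map L _ (complexConj_lineVec_coe L a)).symm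
        (isCompatible_chiSplitting L e₁ dV₁ hdV₁ hdV₁0 _ (complexConj_lineVec_coe L a) (lineVec_coe_ne_zero L a) χ hχu hχs) (k, u') f :=
  finPairRep_chiSplittingLine_eq_of_realDiagonal L e₁ dV₁ hdV₁ hdV₁0 χ hχu hχs _ (complexConj_lineVec_coe L a) (lineVec_coe_ne_zero L a)
    (TW (↥(maximalRealSubfield L)) a) hW hWd (JW (↥(maximalRealSubfield L)) L a) hJW (realDiagonal_lineVec_eq_TW L a)
    (diagonal_lineVec_eq_JW L a) k u u' huu' f

end Pin

end Summit.HodgeConjecture.HodgeConjecture.Cruxes.H413.ThetaJunction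

end
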